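import Literature.MathematicalPhysics.QuantumFieldTheory.Balaban1983to89.B7Eq50Linear
import Literature.MathematicalPhysics.QuantumFieldTheory.Balaban1983to89.B10Eq69Iteration

/-!
# `Balaban1983to89.B10Eq69Concrete` — T. Bałaban, *Ultraviolet stability of three-dimensional lattice pure gauge
# field theories*, Commun. Math. Phys. **102** (1985) 255–275 [Balaban1985UV3]: the large-field inequality (69)
# p. 273, `|Ū_k^j(∂p′) − 1| < Σ_{x∈B^j(x₀)} L^{−3j} Σ_{p⊂(p′)_x} |U_k(∂p) − 1| + O(1)(g_jp(g_j))²`, PROVED for the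
# concrete `j`-fold block average (43) of [4] on `ℤ^d` (model instance `B7Prop2Explicit.avgIter`), with the `O(1)`
# explicit

statement-level skeleton of published theorems with citation tags; proofs where landed; nothing here is a claim
about the Yang–Mills mass gap

PDF held: `paper:balaban1985-cmp102-uv-stability-3d` (journal page = PDF page + 254); p. 273 (PDF 19) read from the
render `b2b-balaban-ref1/pages/1985-cmp102-uv-stability-3d/1985-cmp102-uv-stability-3d-p019-x2.png` AS AN IMAGE (the
held OCR text of the displays is garbled).  "[4]" = T. Bałaban, *Averaging operations for lattice gauge theories*,
CMP **98** (1985) 17–51 [Balaban1985Averaging] (B7): (50) p. 25 in linear form = `B7Eq50Linear.prop1_linear` (same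
seat), (53)/(54) p. 26 = `B7Prop2SpecialUnitary.prop2_explicit_at_lt_two` / `B7Eq50Linear.pdev_avgIter_lt_level`.

WHAT IS REPRODUCED.  SKELETON row `B10.Eq69` (mega-formalization `lit-balaban`, HOME `run/shared/lean/pub/lit-balaban/`,
Phase-2 proof seat `p29`; status before this file: «typed-existing» — the tree held the ARITHMETIC of the iteration,
`B10Eq69Iteration` (abstract remainder sequence `e : ℕ → ℝ`, digit decomposition of the block), and the [4]-side
abstract induction `B7.ineq53_induction`, but no statement about a configuration).  THE PRINTED TEXT (p. 273,
verbatim): *"Let us take a plaquette `p′ ⊂ Λ_j` and such that `|V_j(∂p′) − 1| ≥ g_jp(g_j)`. We have `Ū_k^j = V_j` on `Λ_j`,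
(67) and the configuration `U_k` satisfies the following regularity condition on `B^j(Λ_j)`. `|U_k(∂p) − 1| <
O(1)g_jp(q_j)L^{−2j}` ⟦sic: `p(g_j)`⟧. (68)  Applying the inequalities (50), (53) [4], we have `|Ū_k^j(∂p′) − 1| <
Σ_{x∈B^j(x₀)} L^{−3j} Σ_{p⊂(p′)_x} |U_k(∂p) − 1| + O(1)(g_jp(g_j))²`, (69) where `p′ = ⟨x₀, y₀, z₀, w₀⟩`, `(p′)_x`
denotes the plaquette `p′` transported parallelly to the point `x`, i.e. the lower left corner coincides with the
point `x`."*  Here: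
* `eq69_at` — for `U = U_k` on `ηℤ^d ≅ ℤ^d`, `η = L^{−j}`, with values in a gauge group `G ⊂ {|u| ≤ 1, |u⁻¹| ≤ 1}`
  closed under the average (42) at radius `t` (`AvgClosedAt`), satisfying (68) = (52) of [4] as `sup_p |U(∂p) − 1| <
  α₀L^{−2j}` with the constant `α₀ = O(1)g_jp(g_j)` obeying the Prop.-2 smallness of [4] (`0 < α₀`, `C₀α₀ ≤ ⅓`,
  `2α₀ ≤ c₂′`, `32(d+1)(d+4)L²α₀ ≤ t`): for every plaquette `p′` of the `j`-th lattice,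
  `|Ū^j(∂p′) − 1| ≤ Σ_{x∈B^j(x₀)} L^{−dj} Σ_{p⊂(p′)_x} |U(∂p) − 1| + (16/3)C₀α₀²` (`transSum` = the printed double sum);
* `eq69_concrete` — the same for a group closed at the absolute radius `1/4` (`B7Prop2Explicit.AvgClosed`: the unitary
  group of a C⋆-algebra, `U(N)`), the radius condition being implied by `2α₀ ≤ c₂′`; `eq69_unitaryUnits`,
  `eq69_unitaryGroup` (`G = U(N) ⊂ M_N(ℂ)`, operator norm), `eq69_specialUnitary` (`G = SU(N)`, one `G`-dependent
  smallness `N·32(d+1)(d+4)L²α₀ < π`; these three in the companion `B10Eq70Concrete`, same seat) — the paper's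
  "semi-simple compact Lie group" (Theorem 1 p. 257) includes `SU(N)`;
* the bookkeeping print leaves tacit, as separate declarations: `transSum_zero`/`transSum_succ` (the translates of
  translates reassemble into `B^{j+1}(x₀)` with weight `L^{−d(j+1)}`, and the `(L^{j+1})²` fine plaquettes of a big
  plaquette are `L²` groups of `(L^j)²` — base-`L` digits, `digitEquiv`), `rem`/`rem_le` (the accumulated remainder,
  bounded by the PRE-EXISTING `B10Eq69Iteration.amplified_remainder_le`, invoked by name with `K = 4C₀α₀²`).
PROOF = the printed one ("Applying (50), (53)"): induction over the levels `i ≤ j` of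
`|Ū^i(∂q) − 1| ≤ (level-i sum of q) + rem i`; the step is (50) of [4] in linear form applied to `Ū^i` — admissible
because by (53)/(54) `Ū^i` is `G`-valued with `sup |Ū^i(∂q) − 1| < 2α₀L^{2i}η² ≤ 2α₀ ≤ c₂′`
(`B7Prop2SpecialUnitary.avgIter_mem_at`, `B7Eq50Linear.pdev_avgIter_lt_level`) — whose Prop.-1 remainder
`C₀(L²·2α₀L^{2i}η²)² = 4C₀α₀²L^{4(i+1)}/L^{4j}` is the increment of `rem`, followed by the reassembly `transSum_succ`.
MODEL NOTES.  (M1) `d` general: the printed `L^{−3j}` (`d = 3`) is `L^{−dj}`.  (M2) Identifications (DICTIONARY of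
`B7Prop2Explicit`): the `L^jη`-lattice `≅ ℤ^d`, its plaquette `p′ = (z; μ, ν)` (`μ ≠ ν`), `Ū_k^j(∂p′) =
hol (avgIter L U j) z (plaqWord μ ν)`; on the `η`-lattice `≅ ℤ^d`: `x₀ = L^j z`, `B^j(x₀) = {L^j z + r : r ∈ [0, L^j)^d}`
((2) of [4]), the fine plaquettes of `(p′)_x` are `(x + a e_μ + b e_ν; μ, ν)`, `a, b < L^j`.  (M3) (68) is assumed on
ALL plaquettes of `ηℤ^d` (print: "on `B^j(Λ_j)`"); the printed locality — only `Δ′ = B^j(x₀) ∪ B^j(y₀) ∪ B^j(z₀) ∪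
B^j(w₀)` matters, cf. (70) — is NOT certified here (it would need the local Prop. 1, DIVERGENCE (a) of `B7Prop1Explicit`
/ `B7Prop2Explicit`; `B7Prop1Local` has the clamped-extension device, not threaded through the kept sum).  (M4) `≤` for
the printed `<` in (69) ((68) strict as printed).  (M5) The `O(1)(g_jp(g_j))²` of (69) is EXPLICIT: with `α₀ :=` the
constant of (68) (print: `O(1)g_jp(g_j)`), the remainder is `(16/3)·C₀(d)·α₀²`, `C₀ = 226·(8(d+1)(d+4))²` the
admissible witness of `B7Prop1Explicit` (`(4/3)·4C₀α₀²`: `B10Eq69Iteration`'s `K·L²/(L²−1) ≤ (4/3)K`, `L ≥ 2`).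
(M6) Nothing of rows B10.Eq67/70/71 is asserted here ((70), first inequality, and the `U(N)`/`SU(N)` instances:
companion `B10Eq70Concrete`).
Unit `lit-balaban-p29` (Phase-2 proof seat p29, gen 4); HOME `run/shared/lean/pub/lit-balaban/`.
-/

noncomputable section

open scoped BigOperators
open NormedSpace Finset

namespace Literature.MathematicalPhysics.QuantumFieldTheory.Balaban1983to89.B10Eq69Concrete

open B7Prop1Explicit B7Prop2Explicit B7Prop2SpecialUnitary B7Eq50Linear MatrixLog

-- `Site` alone could resolve to the torus sites of `Setup.lean` through a parent namespace; re-export the `ℤ^d`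
-- sites `Fin d → ℤ` of `B7Prop1Explicit`.
export B7Prop1Explicit (Site)

variable {d : ℕ}

/-! ## §1 The double sum of (69) -/

section Sums

variable {𝔸 : Type*} [NormedRing 𝔸]

/-- The sum of B10 (69) at resolution `n` with weight `w`:
`Σ_{x ∈ B^j(x₀)} w Σ_{p ⊂ (p′)_x} |V(∂p) − 1|`, `B^j(x₀) = {x₀ + r : r ∈ [0, n)^d}`, `x₀ = n·z` the lower-left
corner of the big plaquette `p′` which is the unit plaquette `(z; μ, ν)` of the `j`-th lattice (`n = L^j`,
`w = L^{−dj}`; header DICTIONARY). [cite: Balaban1985UV3, (69) p.273] -/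
def transSumN (n : ℕ) (w : ℝ) (V : Site d → Fin d → 𝔸ˣ) (μ ν : Fin d) (z : Site d) : ℝ :=
  ∑ r : Fin d → Fin n, w * fineSum n V ((n : ℤ) • z + boxVec n r) μ ν

/-- **The right-hand sum of (69)** for the `j`-fold average: `Σ_{x ∈ B^j(x₀)} L^{−dj} Σ_{p ⊂ (p′)_x} |U(∂p) − 1|`
(print, `d = 3`: `L^{−3j}`), `p′ = ⟨x₀, y₀, z₀, w₀⟩` the plaquette of the `L^jη`-lattice which, under the
identification `Ω^{(j)} ≅ ℤ^d` of `B7Prop2Explicit`, is the unit plaquette `(z; μ, ν)`, so `x₀ = L^j z` and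
`B^j(x₀) = {L^j z + r : r ∈ [0, L^j)^d}` ((2) of [4]). [cite: Balaban1985UV3, (69) p.273] -/
def transSum (L : ℕ) (V : Site d → Fin d → 𝔸ˣ) (μ ν : Fin d) (j : ℕ) (z : Site d) : ℝ :=
  transSumN (L ^ j) (((L : ℝ) ^ (d * j))⁻¹) V μ ν z

/-- `transSum_nonneg`: the double sum of (69) is a weighted sum of norms, `≥ 0`. [cite: Balaban1985UV3, (69) p.273] -/
theorem transSum_nonneg (L : ℕ) (V : Site d → Fin d → 𝔸ˣ) (μ ν : Fin d) (j : ℕ) (z : Site d) :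
    0 ≤ transSum L V μ ν j z :=
  Finset.sum_nonneg fun _ _ => mul_nonneg (by positivity) (fineSum_nonneg _ _ _ _ _)

/-- At `j = 0` the sum (69) is the single plaquette deviation `|U(∂p′) − 1|`. [cite: Balaban1985UV3, (69) p.273] -/
theorem transSum_zero (L : ℕ) (V : Site d → Fin d → 𝔸ˣ) (μ ν : Fin d) (z : Site d) :
    transSum L V μ ν 0 z = ‖((hol V z (plaqWord μ ν) : 𝔸ˣ) : 𝔸) - 1‖ := by
  unfold transSum
  rw [pow_zero, mul_zero, pow_zero, inv_one]
  unfold transSumN fineSum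
  rw [Fintype.sum_unique]
  have hb : ∀ r : Fin d → Fin 1, boxVec 1 r = (0 : Site d) := fun r => funext fun κ => by
    simp [boxVec]
  simp [hb]

end Sums

/-! ## §2 Reassembly of the translated plaquettes across levels (the tacit bookkeeping of (69))

The translates of translates of the printed induction reassemble into the block `B^j(x₀)` with the uniform weight
`L^{−dj}`: one base-`L` digit per level (cf. `B10Eq69Iteration.block_sum_eq_nested`, there for nested digits; here the
two-scale form `[0, L·n)^d ≃ [0, L)^d × [0, n)^d` actually used by the induction), and the `(L^{j+1})²` fine plaquettes
of a big plaquette of the next level are `L²` groups of `(L^j)²` fine plaquettes of translated big plaquettes of the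
previous level.  Elementary; not printed. -/

section Reassembly

variable {𝔸 : Type*} [NormedRing 𝔸]

/-- Base-`n` digits of a range sum: `Σ_{A < L·n} f(A) = Σ_{t<L} Σ_{s<n} f(n t + s)`. [folklore] -/
private theorem sum_range_mul_eq (n L : ℕ) (f : ℕ → ℝ) :
    ∑ A ∈ Finset.range (L * n), f A = ∑ t ∈ Finset.range L, ∑ s ∈ Finset.range n, f (n * t + s) := by
  induction L with
  | zero => simp
  | succ L ih =>
    rw [Nat.succ_mul, Finset.sum_range_add, ih, Finset.sum_range_succ]
    congr 1
    refine Finset.sum_congr rfl fun s _ => ?_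
    rw [Nat.mul_comm n L]

/-- The two digits of the fine plaquettes: the `(L·n)²` unit plaquettes of the `(L·n)`-square at `x` are the `n²`
unit plaquettes of the `L²` translated `n`-squares at `x + n(a e_μ + b e_ν)`, `a, b < L`. [folklore] -/
private theorem fineSum_mul (n L : ℕ) (V : Site d → Fin d → 𝔸ˣ) (x : Site d) (μ ν : Fin d) :
    fineSum (L * n) V x μ ν = ∑ a ∈ Finset.range L, ∑ b ∈ Finset.range L,
      fineSum n V (x + ((n * a : ℕ) : ℤ) • e μ + ((n * b : ℕ) : ℤ) • e ν) μ ν := by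
  have key : ∀ a a' b b' : ℕ, x + ((n * a + a' : ℕ) : ℤ) • e μ + ((n * b + b' : ℕ) : ℤ) • e ν
      = x + ((n * a : ℕ) : ℤ) • e μ + ((n * b : ℕ) : ℤ) • e ν + (a' : ℤ) • e μ + (b' : ℤ) • e ν := by
    intro a a' b b'
    push_cast
    simp only [add_smul]
    abel
  unfold fineSum
  simp only [sum_range_mul_eq n L, key]
  refine Finset.sum_congr rfl fun a _ => ?_
  rw [Finset.sum_comm]

/-- The digit bijection of block points: `[0, L)^d × [0, n)^d ≃ [0, L·n)^d`, `(r, r′) ↦ n·r + r′` coordinatewise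
(Mathlib's `finProdFinEquiv` in every coordinate). [folklore] -/
def digitEquiv (d n L : ℕ) : (Fin d → Fin L) × (Fin d → Fin n) ≃ (Fin d → Fin (L * n)) where
  toFun p κ := finProdFinEquiv (p.1 κ, p.2 κ)
  invFun R := (fun κ => (finProdFinEquiv.symm (R κ)).1, fun κ => (finProdFinEquiv.symm (R κ)).2)
  left_inv p := by
    obtain ⟨r, r'⟩ := p
    simp only [Equiv.symm_apply_apply]
  right_inv R := by
    funext κ
    simp only [Prod.mk.eta, Equiv.apply_symm_apply]

/-- The block point with digits `(r, r′)` is `n·r + r′`: `B^{j+1}(0) ∋ x = L^j r + r′`, `r ∈ B(0)`, `r′ ∈ B^j(0)`. [folklore] -/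
private theorem boxVec_digitEquiv (n L : ℕ) (r : Fin d → Fin L) (r' : Fin d → Fin n) :
    boxVec (L * n) (digitEquiv d n L (r, r')) = (n : ℤ) • boxVec L r + boxVec n r' := by
  funext κ
  simp only [boxVec, digitEquiv, Equiv.coe_fn_mk, finProdFinEquiv_apply_val, Pi.add_apply, Pi.smul_apply,
    smul_eq_mul]
  push_cast
  ring

/-- **One level of reassembly:** the weighted sum over the block of the `(L·n)`-lattice of the fine sums of
`(L·n)`-squares equals the one-step block average (`L^{−d}`, `L²` sub-plaquettes) of the same quantity one level
down (blocks and squares of size `n`, base points read on the `L`-lattice). [folklore] -/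
private theorem transSumN_mul (n L : ℕ) (w : ℝ) (V : Site d → Fin d → 𝔸ˣ) (μ ν : Fin d) (z : Site d) :
    transSumN (L * n) (((L : ℝ) ^ d)⁻¹ * w) V μ ν z =
      ∑ r : Fin d → Fin L, ((L : ℝ) ^ d)⁻¹ * ∑ a ∈ Finset.range L, ∑ b ∈ Finset.range L,
        transSumN n w V μ ν ((L : ℤ) • z + boxVec L r + (a : ℤ) • e μ + (b : ℤ) • e ν) := by
  have key : ∀ (r : Fin d → Fin L) (r' : Fin d → Fin n) (a b : ℕ),
      ((L * n : ℕ) : ℤ) • z + ((n : ℤ) • boxVec L r + boxVec n r') + ((n * a : ℕ) : ℤ) • e μ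
        + ((n * b : ℕ) : ℤ) • e ν
      = (n : ℤ) • ((L : ℤ) • z + boxVec L r + (a : ℤ) • e μ + (b : ℤ) • e ν) + boxVec n r' := by
    intro r r' a b
    push_cast
    module
  unfold transSumN
  rw [← (digitEquiv d n L).sum_comp, Fintype.sum_prod_type]
  refine Finset.sum_congr rfl fun r _ => ?_
  simp only [boxVec_digitEquiv, fineSum_mul n L, Finset.mul_sum, key]
  rw [Finset.sum_comm]
  refine Finset.sum_congr rfl fun a _ => ?_
  rw [Finset.sum_comm]
  refine Finset.sum_congr rfl fun b _ => Finset.sum_congr rfl fun r' _ => ?_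
  ring

/-- **The reassembly step of (69):** `Σ_{x∈B^{j+1}(x₀)} L^{−d(j+1)} Σ_{p⊂(p′)_x} |U(∂p) − 1|` for the unit plaquette
`(z; μ, ν)` of the `(j+1)`-st lattice equals the one-step block average `Σ_{y} L^{−d} Σ_{q ⊂ (p′)_y}` over the `L²`
unit plaquettes `q = (Lz + r + a e_μ + b e_ν; μ, ν)` of the `j`-th lattice of the level-`j` sums (69) of `q`. [cite: Balaban1985UV3, (69) p.273] -/
theorem transSum_succ (L : ℕ) (hL : 1 ≤ L) (V : Site d → Fin d → 𝔸ˣ) (μ ν : Fin d) (j : ℕ) (z : Site d) :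
    transSum L V μ ν (j + 1) z =
      ∑ r : Fin d → Fin L, ((L : ℝ) ^ d)⁻¹ * ∑ a ∈ Finset.range L, ∑ b ∈ Finset.range L,
        transSum L V μ ν j ((L : ℤ) • z + boxVec L r + (a : ℤ) • e μ + (b : ℤ) • e ν) := by
  have hL0 : (L : ℝ) ≠ 0 := by exact_mod_cast (by omega : L ≠ 0)
  have hw : ((L : ℝ) ^ (d * (j + 1)))⁻¹ = ((L : ℝ) ^ d)⁻¹ * ((L : ℝ) ^ (d * j))⁻¹ := by
    rw [← mul_inv, ← pow_add]; ring_nf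
  unfold transSum
  rw [pow_succ', hw]
  exact transSumN_mul (L ^ j) L _ V μ ν z

end Reassembly

/-! ## §3 (69) for the concrete `j`-fold average (43) of [4] on `ℤ^d` -/

section Main

variable {𝔸 : Type*} [NormedRing 𝔸] [NormOneClass 𝔸] [NormedAlgebra ℂ 𝔸] [CompleteSpace 𝔸]

/-- The accumulated remainder after `i` levels of iterating (50) towards level `j` (the `e i` of
`B10Eq69Iteration.amplified_remainder_le`, here WITH EQUALITY): `rem 0 = 0`,
`rem (i+1) = L²·rem i + K·L^{4(i+1)}/L^{4j}` (`L²` = the number of sub-plaquettes of a translated big plaquette,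
`K·L^{4(i+1)−4j} = C₀(L²a_i)²` the Prop.-1 remainder at level `i`, `a_i = 2α₀L^{2i}/L^{2j}` by (53)/(54), `K = 4C₀α₀²`).
[cite: Balaban1985UV3, (69) p.273; Balaban1985Averaging, (50) p.25, (53) p.26] -/
def rem (L K : ℝ) (j : ℕ) : ℕ → ℝ
  | 0 => 0
  | i + 1 => L ^ 2 * rem L K j i + K * L ^ (4 * (i + 1)) / L ^ (4 * j)

/-- `rem` — unfolding at `0`. [cite: Balaban1985UV3, (69) p.273] -/
@[simp] theorem rem_zero (L K : ℝ) (j : ℕ) : rem L K j 0 = 0 := rfl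

/-- `rem` — unfolding at a successor. [cite: Balaban1985UV3, (69) p.273] -/
theorem rem_succ (L K : ℝ) (j i : ℕ) :
    rem L K j (i + 1) = L ^ 2 * rem L K j i + K * L ^ (4 * (i + 1)) / L ^ (4 * j) := rfl

/-- **The `O(1)(g_jp(g_j))²` of (69):** after `j` levels the remainder is `≤ K·L²/(L²−1) ≤ (4/3)K` — the tree's
bookkeeping `B10Eq69Iteration.amplified_remainder_le`, invoked by name. [cite: Balaban1985UV3, (69) p.273] -/
theorem rem_le (L K : ℝ) (hL : 2 ≤ L) (hK : 0 ≤ K) (j : ℕ) : rem L K j j ≤ 4 / 3 * K := by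
  have h := B10Eq69Iteration.amplified_remainder_le L K hL hK j (rem L K j) (le_of_eq (rem_zero L K j))
    (fun i _ => le_of_eq (rem_succ L K j i))
  exact h.1.trans h.2

/-- **B10 (69), kernel-checked for the concrete `j`-fold average (43) of [4] on `ℤ^d`, gauge group closed under
the average at radius `t`.**  Print (p. 273): *"the configuration `U_k` satisfies the following regularity condition
on `B^j(Λ_j)`. `|U_k(∂p) − 1| < O(1)g_jp(g_j)L^{−2j}`. (68)  Applying the inequalities (50), (53) [4], we have
`|Ū_k^j(∂p′) − 1| < Σ_{x∈B^j(x₀)} L^{−3j} Σ_{p⊂(p′)_x} |U_k(∂p) − 1| + O(1)(g_jp(g_j))²`, (69) where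
`p′ = ⟨x₀, y₀, z₀, w₀⟩`, `(p′)_x` denotes the plaquette `p′` transported parallelly to the point `x`, i.e. the lower
left corner coincides with the point `x`."*  Here: `U = U_k` a configuration on `ηℤ^d ≅ ℤ^d` (`η = L^{−j}`; read on
the unit lattice, header DICTIONARY) with values in `G ⊂ {|u| ≤ 1, |u⁻¹| ≤ 1}` closed under (42) at radius `t`
(`AvgClosedAt`), satisfying (68) = (52) of [4] in the form `sup_p |U(∂p) − 1| < α₀·L^{−2j}` with the constant
`α₀ = O(1)g_jp(g_j)` obeying the Prop.-2 smallness of [4] (`C₀α₀ ≤ ⅓`, `2α₀ ≤ c₂′`, `32(d+1)(d+4)L²α₀ ≤ t`); then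
for every plaquette `p′` of the `j`-th lattice (lower-left corner `x₀ = L^j z`, spanned by `e_μ ≠ e_ν`):
`|Ū^j(∂p′) − 1| ≤ Σ_{x∈B^j(x₀)} L^{−dj} Σ_{p⊂(p′)_x} |U(∂p) − 1| + (16/3)C₀α₀²` — (69) with `d` general
(`L^{−3j}` ↦ `L^{−dj}`) and its `O(1)(g_jp(g_j))²` EXPLICIT: `(16/3)·C₀(d)·α₀²`, `C₀ = 14464(d+1)²(d+4)²`.
PROOF = the printed one: induction over the levels `i ≤ j` of `|Ū^i(∂q) − 1| ≤ (level-i sum) + rem i` — (50) of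
[4] in linear form at each level (`prop1_linear`, applicable since by (53)/(54) `Ū^i` is `G`-valued with
`sup |Ū^i(∂q) − 1| < 2α₀L^{2i}η² ≤ c₂′`, `pdev_avgIter_lt_level`, `avgIter_mem_at`), the reassembly `transSum_succ`,
and the remainder bookkeeping `B10Eq69Iteration.amplified_remainder_le` (`rem_le`).  (68) is assumed on all of
`ηℤ^d` (print: on `B^j(Λ_j)`; locality as in `B7Prop2Explicit`, DIVERGENCE (a)). [cite: Balaban1985UV3, (68)–(69) p.273] -/
theorem eq69_at (L : ℕ) (hL : 2 ≤ L) {G : Subgroup 𝔸ˣ} {t : ℝ} (hG : AvgClosedAt d t L G) (j : ℕ)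
    (V : Site d → Fin d → 𝔸ˣ) (hV : ∀ x κ, V x κ ∈ G) {α₀ : ℝ} (hα : 0 < α₀)
    (hα3 : C0 d * α₀ ≤ 1 / 3) (hα2 : 2 * α₀ ≤ c2' d L)
    (hαt : 32 * ((d : ℝ) + 1) * (d + 4) * (L : ℝ) ^ 2 * α₀ ≤ t)
    (h68 : pdev V < α₀ * (((L : ℝ) ^ j)⁻¹) ^ 2) (z : Site d) {μ ν : Fin d} (hμν : μ ≠ ν) :
    ‖((hol (avgIter L V j) z (plaqWord μ ν) : 𝔸ˣ) : 𝔸) - 1‖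
      ≤ transSum L V μ ν j z + 16 / 3 * C0 d * α₀ ^ 2 := by
  have hL1 : 1 ≤ L := le_trans (by norm_num) hL
  have hLr : (2 : ℝ) ≤ L := by exact_mod_cast hL
  have hL1r : (1 : ℝ) ≤ L := by linarith
  have hLpos : (0 : ℝ) < L := by linarith
  have hC := C0_pos d
  have hmem := avgIter_mem_at L hL hG j V hV hα hα3 hα2 hαt h68
  have hlev := pdev_avgIter_lt_level L hL hG j V hV hα hα3 hα2 hαt h68
  set K : ℝ := 4 * C0 d * α₀ ^ 2 with hK
  have hK0 : 0 ≤ K := by positivity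
  -- the smallness of `2α₀` for Prop. 1 / (50) at every level: `512(d+1)(d+4)L²·(2α₀) ≤ 1`
  have hpos512 : (0 : ℝ) < 512 * ((d : ℝ) + 1) * (d + 4) * (L : ℝ) ^ 2 := by positivity
  have hsmall2 : 512 * (d + 1) * (d + 4) * (L : ℝ) ^ 2 * (2 * α₀) ≤ 1 := by
    have h1 : 2 * α₀ ≤ 1 / (512 * ((d : ℝ) + 1) * (d + 4) * (L : ℝ) ^ 2) := hα2
    rw [le_div_iff₀ hpos512] at h1
    linarith
  suffices H : ∀ i, i ≤ j → ∀ z : Site d, ‖((hol (avgIter L V i) z (plaqWord μ ν) : 𝔸ˣ) : 𝔸) - 1‖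
      ≤ transSum L V μ ν i z + rem (L : ℝ) K j i by
    have hr := rem_le (L : ℝ) K hLr hK0 j
    have h := H j le_rfl z
    have hK' : 4 / 3 * K = 16 / 3 * C0 d * α₀ ^ 2 := by rw [hK]; ring
    linarith
  intro i
  induction i with
  | zero =>
      intro _ z
      rw [transSum_zero, avgIter_zero, rem_zero, add_zero]
  | succ i ih =>
      intro hij z
      have hile : i ≤ j := Nat.le_of_succ_le hij
      set W : Site d → Fin d → 𝔸ˣ := avgIter L V i with hWdef
      have hWG : ∀ x κ, W x κ ∈ G := hmem i hile
      have hWU : ∀ x κ, W x κ ∈ U1 𝔸 := fun x κ => hG.le_U1 (hWG x κ)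
      -- the level-`i` constant of (53)/(54)
      set P : ℝ := 2 * (α₀ * ((L : ℝ) ^ i * ((L : ℝ) ^ j)⁻¹) ^ 2) with hPdef
      have hPlt : pdev W < P := hlev i hile
      have hratio : ((L : ℝ) ^ i * ((L : ℝ) ^ j)⁻¹) ^ 2 ≤ 1 := by
        have h1 : (L : ℝ) ^ i * ((L : ℝ) ^ j)⁻¹ ≤ 1 := by
          rw [← div_eq_mul_inv, div_le_one (by positivity)]
          exact pow_le_pow_right₀ hL1r hile
        exact pow_le_one₀ (by positivity) h1
      have hP0 : 0 ≤ P := by positivity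
      have hP2 : P ≤ 2 * α₀ := by
        rw [hPdef]
        nlinarith [mul_le_of_le_one_right hα.le hratio]
      have hsmallP : 512 * (d + 1) * (d + 4) * (L : ℝ) ^ 2 * P ≤ 1 :=
        (mul_le_mul_of_nonneg_left hP2 hpos512.le).trans hsmall2
      have h44P : ∀ (x : Site d) (κ κ' : Fin d), κ ≠ κ' → ‖((hol W x (plaqWord κ κ') : 𝔸ˣ) : 𝔸) - 1‖ ≤ P :=
        fun x κ κ' _ => (le_pdev hWU x κ κ').trans hPlt.le
      -- (50) of [4], linear form, at level `i`
      have h50 := prop1_linear L hL1 ((L : ℤ) • z) hμν W hWU hP0 hsmallP h44P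
      -- the induction hypothesis under the block average: reassembly
      have ih' : ∀ y : Site d, ‖((hol W y (plaqWord μ ν) : 𝔸ˣ) : 𝔸) - 1‖
          ≤ transSum L V μ ν i y + rem (L : ℝ) K j i := ih hile
      have hblock : blockFineAvg L W ((L : ℤ) • z) μ ν
          ≤ transSum L V μ ν (i + 1) z + (L : ℝ) ^ 2 * rem (L : ℝ) K j i := by
        rw [transSum_succ L hL1]
        have hconst : ∑ _r : Fin d → Fin L, ((L : ℝ) ^ d)⁻¹ *
            ∑ _a ∈ Finset.range L, ∑ _b ∈ Finset.range L, rem (L : ℝ) K j i = (L : ℝ) ^ 2 * rem (L : ℝ) K j i := by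
          have h1 : ∑ _a ∈ Finset.range L, ∑ _b ∈ Finset.range L, rem (L : ℝ) K j i
              = (L : ℝ) ^ 2 * rem (L : ℝ) K j i := by
            rw [Finset.sum_const, Finset.sum_const, Finset.card_range, nsmul_eq_mul, nsmul_eq_mul]; ring
          rw [h1, ← Finset.sum_mul, sum_weights L hL1, one_mul]
        rw [← hconst, ← Finset.sum_add_distrib]
        unfold blockFineAvg fineSum
        refine Finset.sum_le_sum fun r _ => ?_
        rw [← mul_add, ← Finset.sum_add_distrib]
        refine mul_le_mul_of_nonneg_left ?_ (by positivity)
        refine Finset.sum_le_sum fun a _ => ?_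
        rw [← Finset.sum_add_distrib]
        exact Finset.sum_le_sum fun b _ => ih' _
      -- the Prop.-1 remainder at level `i` is the increment of `rem`
      have hPK : C0 d * ((L : ℝ) ^ 2 * P) ^ 2 = K * (L : ℝ) ^ (4 * (i + 1)) / (L : ℝ) ^ (4 * j) := by
        have hLj : (L : ℝ) ^ j ≠ 0 := by positivity
        rw [hPdef, hK]
        field_simp
        ring
      rw [avgIter_succ, hol_rescale_plaqWord, rem_succ, ← hPK]
      calc _ ≤ blockFineAvg L W ((L : ℤ) • z) μ ν + C0 d * ((L : ℝ) ^ 2 * P) ^ 2 := h50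
        _ ≤ _ := by linarith

/-- **B10 (69) for a gauge group closed under the average at the absolute radius `1/4`** (`B7Prop2Explicit.AvgClosed`,
e.g. the unitary group of a C⋆-algebra — `U(N) ⊂ M_N(ℂ)` with the operator norm): `eq69_at` with the radius condition
discharged by `2α₀ ≤ c₂′` (`32(d+1)(d+4)L²α₀ ≤ 1/32 ≤ 1/4`). [cite: Balaban1985UV3, (68)–(69) p.273] -/
theorem eq69_concrete (L : ℕ) (hL : 2 ≤ L) {G : Subgroup 𝔸ˣ} (hG : AvgClosed d L G) (j : ℕ)
    (V : Site d → Fin d → 𝔸ˣ) (hV : ∀ x κ, V x κ ∈ G) {α₀ : ℝ} (hα : 0 < α₀)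
    (hα3 : C0 d * α₀ ≤ 1 / 3) (hα2 : 2 * α₀ ≤ c2' d L)
    (h68 : pdev V < α₀ * (((L : ℝ) ^ j)⁻¹) ^ 2) (z : Site d) {μ ν : Fin d} (hμν : μ ≠ ν) :
    ‖((hol (avgIter L V j) z (plaqWord μ ν) : 𝔸ˣ) : 𝔸) - 1‖
      ≤ transSum L V μ ν j z + 16 / 3 * C0 d * α₀ ^ 2 := by
  have hL1 : (1 : ℝ) ≤ L := by exact_mod_cast le_trans (by norm_num) hL
  have hpos : (0 : ℝ) < 512 * ((d : ℝ) + 1) * (d + 4) * (L : ℝ) ^ 2 := by positivity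
  have ht : 32 * ((d : ℝ) + 1) * (d + 4) * (L : ℝ) ^ 2 * α₀ ≤ 1 / 4 := by
    have h1 : 2 * α₀ ≤ 1 / (512 * ((d : ℝ) + 1) * (d + 4) * (L : ℝ) ^ 2) := hα2
    rw [le_div_iff₀ hpos] at h1
    linarith
  exact eq69_at L hL (avgClosedAt_of_avgClosed hG le_rfl) j V hV hα hα3 hα2 ht h68 z hμν

end Main

end Literature.MathematicalPhysics.QuantumFieldTheory.Balaban1983to89.B10Eq69Concrete
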